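import Summits.AtomisticToContinuum.FouriersLaw.Theorems.OddSectorIrreversibilityOddCorrectorDecayCurrentVarianceC
import Mathlib.Analysis.Convex.Integral
import Mathlib.Analysis.Convex.SpecificFunctions.Basic
import Mathlib.Analysis.Convex.Mul

/-!
# Pointwise inequalities for the bath-locality estimate, I: weights are dominated by one-site sums

Support file for item `stmt-AtomisticToContinuum-9139` (`OddSectorIrreversibility.OddCorrectorDecay`), negative
side. Deterministic algebra turning the pathwise product bound `(ΔJ)² ≤ (W · G · E)²`
(`ChainVariation.sq_totalCurrent_sub_le_path`) into a SUM of terms each of which is either a one-site sum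
`Ψ_κ(v) = ∑_i (e^{κ q_i²} + p_i^{12} + 1)` evaluated on the open or the closed chain at one time, or a time
average of such:
* `mul_mul_sq_le_of_pos` — AM–GM with a free parameter `λ > 0`: `(WGE)² ≤ (λ³W⁶ + λ³E⁶ + G⁶/λ⁶)/3`;
* `apply_sup'_le_sum`, `sum_ite_succ_eq` — a nonnegative function of a finite maximum is at most the sum;
* `abs_deriv_V_sub_pow_six_le` — `|V'(a-b)|⁶ ≤ 3(e^{(4+24β)a²} + e^{(4+24β)b²})` for `V'(r) = r + βr³`;
* `weight_pow_six_le_oneSiteSum` — `W⁶ ≤ 1216 (Ψ_κ(z) + Ψ_κ(y))` for `κ ≥ 4 + 24β, 144β`;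
* `exp_mul_coeff_le_oneSiteSum` — `exp(6t A) ≤ e^{6t₀(ω₂+4)} (Ψ_κ(z) + Ψ_κ(y))` for the Grönwall coefficient
  `A = (ω₂+4) + (3lam+48β) max_i max(q_i(z)², q_i(y)²)`, `0 ≤ t ≤ t₀`, `κ ≥ 6t₀(3lam+48β)`;
* `exp_intervalIntegral_le`, `intervalIntegral_pow_six_le` — Jensen in time:
  `exp(∫₀ᵗ f) ≤ t⁻¹ ∫₀ᵗ exp(t f)` and `(∫₀ᵗ f)⁶ ≤ t⁵ ∫₀ᵗ f⁶` for continuous `f`, `t > 0`.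
-/

noncomputable section

open MeasureTheory Set Finset intervalIntegral
open Literature.MathematicalPhysics.KineticTheory.HeatConduction

namespace Summit.AtomisticToContinuum.FouriersLaw.Theorems.ChainVariation

variable {N : ℕ}

/-! ### Elementary inequalities -/

/-- AM–GM for three nonnegative reals: `abc ≤ (a³ + b³ + c³)/3`. [folklore] -/
theorem mul_mul_le_add_pow_three {a b c : ℝ} (ha : 0 ≤ a) (hb : 0 ≤ b) (hc : 0 ≤ c) :
    a * b * c ≤ (a ^ 3 + b ^ 3 + c ^ 3) / 3 := by
  nlinarith [mul_nonneg (add_nonneg (add_nonneg ha hb) hc)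
    (add_nonneg (add_nonneg (sq_nonneg (a - b)) (sq_nonneg (b - c))) (sq_nonneg (c - a))),
    mul_nonneg ha hb, mul_nonneg hb hc, mul_nonneg ha hc]

/-- **AM–GM with a free parameter**: `(W G E)² ≤ (λ³ W⁶ + λ³ E⁶ + G⁶/λ⁶)/3` for `λ > 0`
(`W²G²E² = (λW²)(λE²)(G²/λ²)`). [folklore] -/
theorem mul_mul_sq_le_of_pos (W G E : ℝ) {lam' : ℝ} (hl : 0 < lam') :
    (W * G * E) ^ 2 ≤ (lam' ^ 3 * W ^ 6 + lam' ^ 3 * E ^ 6 + G ^ 6 / lam' ^ 6) / 3 := by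
  have h := mul_mul_le_add_pow_three (a := lam' * W ^ 2) (b := lam' * E ^ 2) (c := G ^ 2 / lam' ^ 2)
    (by positivity) (by positivity) (by positivity)
  have e1 : lam' * W ^ 2 * (lam' * E ^ 2) * (G ^ 2 / lam' ^ 2) = (W * G * E) ^ 2 := by
    field_simp
  have e2 : ((lam' * W ^ 2) ^ 3 + (lam' * E ^ 2) ^ 3 + (G ^ 2 / lam' ^ 2) ^ 3) / 3 =
      (lam' ^ 3 * W ^ 6 + lam' ^ 3 * E ^ 6 + G ^ 6 / lam' ^ 6) / 3 := by
    field_simp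
  rw [← e1, ← e2]
  exact h

/-- `(a + b)⁶ ≤ 32 (a⁶ + b⁶)`. [folklore] -/
theorem add_pow_six_le (a b : ℝ) : (a + b) ^ 6 ≤ 32 * (a ^ 6 + b ^ 6) := by
  have h := sub_pow_six_le a (-b)
  rwa [sub_neg_eq_add, show (-b) ^ 6 = b ^ 6 by ring] at h

/-- `(a + b + c)⁶ ≤ 1024 (a⁶ + b⁶ + c⁶)` for `c ≥ 0`-free reals. [folklore] -/
theorem add_add_pow_six_le (a b c : ℝ) : (a + b + c) ^ 6 ≤ 1024 * (a ^ 6 + b ^ 6 + c ^ 6) := by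
  have h1 := add_pow_six_le (a + b) c
  have h2 := add_pow_six_le a b
  have hc : 0 ≤ c ^ 6 := by positivity
  nlinarith

/-- `2 a b ≤ a² + b²` in the form `(2 a b)⁶-free`: `(2 x y)⁶ = 64 x⁶ y⁶ ≤ 32 (x^{12} + y^{12})`. [folklore] -/
theorem two_mul_mul_pow_six_le (x y : ℝ) : (2 * x * y) ^ 6 ≤ 32 * (x ^ 12 + y ^ 12) := by
  nlinarith [sq_nonneg (x ^ 6 - y ^ 6)]

/-- `r⁶ ≤ 6 e^{r²}` (`(r²)³/3! ≤ e^{r²}`). [folklore] -/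
theorem pow_six_le_exp_sq (r : ℝ) : r ^ 6 ≤ 6 * Real.exp (r ^ 2) := by
  have h := Real.pow_div_factorial_le_exp (r ^ 2) (sq_nonneg r) 3
  have h6 : ((Nat.factorial 3 : ℕ) : ℝ) = 6 := by norm_num [Nat.factorial]
  rw [h6, div_le_iff₀ (by norm_num : (0:ℝ) < 6)] at h
  calc r ^ 6 = (r ^ 2) ^ 3 := by ring
    _ ≤ Real.exp (r ^ 2) * 6 := h
    _ = 6 * Real.exp (r ^ 2) := by ring

/-- A nonnegative function of a finite maximum is at most the sum: `φ(max_i f_i) ≤ ∑_i φ(f_i)`. [folklore] -/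
theorem apply_sup'_le_sum {ι : Type*} {s : Finset ι} (hs : s.Nonempty) (f : ι → ℝ) {φ : ℝ → ℝ}
    (hφ : ∀ x, 0 ≤ φ x) : φ (s.sup' hs f) ≤ ∑ i ∈ s, φ (f i) := by
  obtain ⟨i, hi, he⟩ := Finset.exists_mem_eq_sup' hs f
  rw [he]
  exact Finset.single_le_sum (f := fun j => φ (f j)) (fun j _ => hφ _) hi

/-- The bond sum `∑_j [j = i+1] a_j` has at most one term. [folklore] -/
theorem sum_ite_succ_eq (i : Fin N) (a : Fin N → ℝ) :
    (∑ j : Fin N, if j.val = i.val + 1 then a j else 0) =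
      if h : i.val + 1 < N then a ⟨i.val + 1, h⟩ else 0 := by
  by_cases h : i.val + 1 < N
  · rw [dif_pos h, Finset.sum_eq_single_of_mem (⟨i.val + 1, h⟩ : Fin N) (Finset.mem_univ _)]
    · simp
    · intro j _ hj
      rw [if_neg]
      intro e
      exact hj (Fin.ext e)
  · rw [dif_neg h]
    refine Finset.sum_eq_zero fun j _ => ?_
    rw [if_neg]
    intro e
    exact h (e ▸ j.isLt)

/-- Hence `(∑_j [j = i+1] a_j)⁶ = ∑_j [j = i+1] a_j⁶`. [folklore] -/
theorem sum_ite_succ_pow_six (i : Fin N) (a : Fin N → ℝ) :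
    (∑ j : Fin N, if j.val = i.val + 1 then a j else 0) ^ 6 =
      ∑ j : Fin N, if j.val = i.val + 1 then a j ^ 6 else 0 := by
  rw [sum_ite_succ_eq, sum_ite_succ_eq i (fun j => a j ^ 6)]
  split_ifs <;> simp

/-- **The coupling force is exponentially dominated by one-site terms**: for `V'(r) = r + βr³` (`β ≥ 0`),
`|V'(a - b)|⁶ ≤ 3 (e^{(4+24β) a²} + e^{(4+24β) b²})`. [folklore] -/
theorem abs_deriv_V_sub_pow_six_le {β : ℝ} (hβ : 0 ≤ β) (ω₂ lam γ a b : ℝ) :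
    |deriv (pinnedChain ω₂ lam β γ).V (a - b)| ^ 6 ≤
      3 * (Real.exp ((4 + 24 * β) * a ^ 2) + Real.exp ((4 + 24 * β) * b ^ 2)) := by
  rw [pinnedChain_deriv_V]
  set r := a - b with hr
  have h1 : |r + β * r ^ 3| ^ 6 = r ^ 6 * (1 + β * r ^ 2) ^ 6 := by
    have : r + β * r ^ 3 = r * (1 + β * r ^ 2) := by ring
    rw [this, abs_mul, abs_of_nonneg (by positivity : 0 ≤ 1 + β * r ^ 2), mul_pow, pow_abs,
      abs_of_nonneg (by positivity : 0 ≤ r ^ 6)]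
  have h2 : r ^ 6 * (1 + β * r ^ 2) ^ 6 ≤ 6 * Real.exp ((1 + 6 * β) * r ^ 2) := by
    have ha := pow_six_le_exp_sq r
    have hb : (1 + β * r ^ 2) ^ 6 ≤ Real.exp ((6:ℕ) * (β * r ^ 2)) := by
      rw [Real.exp_nat_mul]
      exact pow_le_pow_left₀ (by positivity) (by linarith [Real.add_one_le_exp (β * r ^ 2)]) 6
    calc r ^ 6 * (1 + β * r ^ 2) ^ 6 ≤ 6 * Real.exp (r ^ 2) * Real.exp ((6:ℕ) * (β * r ^ 2)) :=
          mul_le_mul ha hb (by positivity) (by positivity)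
      _ = 6 * Real.exp ((1 + 6 * β) * r ^ 2) := by
          rw [mul_assoc, ← Real.exp_add]; congr 1; push_cast; ring_nf
  have h3 : (1 + 6 * β) * r ^ 2 ≤ (2 + 12 * β) * a ^ 2 + (2 + 12 * β) * b ^ 2 := by
    have : r ^ 2 ≤ 2 * a ^ 2 + 2 * b ^ 2 := by rw [hr]; nlinarith [sq_nonneg (a + b)]
    nlinarith
  have h4 : Real.exp ((1 + 6 * β) * r ^ 2) ≤
      (Real.exp ((4 + 24 * β) * a ^ 2) + Real.exp ((4 + 24 * β) * b ^ 2)) / 2 := by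
    calc Real.exp ((1 + 6 * β) * r ^ 2) ≤ Real.exp ((2 + 12 * β) * a ^ 2 + (2 + 12 * β) * b ^ 2) :=
          Real.exp_le_exp.2 h3
      _ = Real.exp ((2 + 12 * β) * a ^ 2) * Real.exp ((2 + 12 * β) * b ^ 2) := Real.exp_add _ _
      _ ≤ (Real.exp ((2 + 12 * β) * a ^ 2) ^ 2 + Real.exp ((2 + 12 * β) * b ^ 2) ^ 2) / 2 := by
          nlinarith [sq_nonneg (Real.exp ((2 + 12 * β) * a ^ 2) - Real.exp ((2 + 12 * β) * b ^ 2))]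
      _ = _ := by
          rw [← Real.exp_nat_mul, ← Real.exp_nat_mul]; congr 2 <;> push_cast <;> ring
  rw [h1]
  linarith

/-- `e^{c max(a,b)} ≤ e^{c a} + e^{c b}`. [folklore] -/
theorem exp_mul_max_le (c a b : ℝ) : Real.exp (c * max a b) ≤ Real.exp (c * a) + Real.exp (c * b) := by
  rcases le_total a b with h | h
  · rw [max_eq_right h]; linarith [Real.exp_pos (c * a)]
  · rw [max_eq_left h]; linarith [Real.exp_pos (c * b)]

/-- Monotonicity of the one-site exponential in the rate. [folklore] -/
theorem exp_mul_sq_mono {κ' κ : ℝ} (h : κ' ≤ κ) (a : ℝ) : Real.exp (κ' * a ^ 2) ≤ Real.exp (κ * a ^ 2) :=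
  Real.exp_le_exp.2 (mul_le_mul_of_nonneg_right h (sq_nonneg a))

/-! ### The weights of the pathwise bound are dominated by one-site sums -/

/-- The one-site sum dominates the sum of its exponential and momentum parts. [folklore] -/
theorem le_oneSiteSum_aux (κ : ℝ) (v : PhaseSpace N) :
    (∑ i, Real.exp (κ * (v.1 i) ^ 2) + ∑ i, (v.2 i) ^ 12 ≤ ∑ i, (Real.exp (κ * (v.1 i) ^ 2) + (v.2 i) ^ 12 + 1)) ∧
    (0 ≤ ∑ i, Real.exp (κ * (v.1 i) ^ 2)) ∧ (0 ≤ ∑ i, (v.2 i) ^ 12) := by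
  refine ⟨?_, Finset.sum_nonneg fun i _ => (Real.exp_pos _).le, Finset.sum_nonneg fun i _ => by positivity⟩
  rw [← Finset.sum_add_distrib]
  exact Finset.sum_le_sum fun i _ => by linarith

/-- **`W⁶ ≤ 1216 (Ψ_κ(z) + Ψ_κ(y))`** for the current weight of `sq_totalCurrent_sub_le_path`,
`W = max_i ∑_j[j=i+1]|V'(q_j(z)-q_i(z))| + 2 max_i|p_i(y)| (1 + 12β max_i max(q_i(z)², q_i(y)²))`, with
`Ψ_κ(v) = ∑_i (e^{κ q_i²} + p_i^{12} + 1)` and any `κ ≥ 4 + 24β`, `κ ≥ 144β`. [folklore] -/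
theorem weight_pow_six_le_oneSiteSum {β : ℝ} (hβ : 0 ≤ β) (ω₂ lam γ : ℝ) (hne : (Finset.univ : Finset (Fin N)).Nonempty)
    {κ : ℝ} (hκ₁ : 4 + 24 * β ≤ κ) (hκ₂ : 144 * β ≤ κ) (z y : PhaseSpace N) :
    ((Finset.univ.sup' hne (fun i : Fin N => ∑ j : Fin N, if j.val = i.val + 1 then
        |deriv (pinnedChain ω₂ lam β γ).V (z.1 j - z.1 i)| else 0)) +
      2 * (Finset.univ.sup' hne (fun i : Fin N => |y.2 i|)) *
        (1 + 12 * β * (Finset.univ.sup' hne (fun i : Fin N => max (z.1 i ^ 2) (y.1 i ^ 2))))) ^ 6 ≤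
      1216 * ((∑ i, (Real.exp (κ * (z.1 i) ^ 2) + (z.2 i) ^ 12 + 1)) +
        ∑ i, (Real.exp (κ * (y.1 i) ^ 2) + (y.2 i) ^ 12 + 1)) := by
  set P := pinnedChain ω₂ lam β γ with hP
  set f : Fin N → ℝ := fun i => ∑ j : Fin N, if j.val = i.val + 1 then |deriv P.V (z.1 j - z.1 i)| else 0 with hf
  set BV := Finset.univ.sup' hne f with hBV
  set Bp := Finset.univ.sup' hne (fun i : Fin N => |y.2 i|) with hBp
  set Mq := Finset.univ.sup' hne (fun i : Fin N => max (z.1 i ^ 2) (y.1 i ^ 2)) with hMq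
  set ez : Fin N → ℝ := fun i => Real.exp (κ * (z.1 i) ^ 2) with hez
  set ey : Fin N → ℝ := fun i => Real.exp (κ * (y.1 i) ^ 2) with hey
  obtain ⟨i₀, hi₀⟩ := hne
  have hMq0 : 0 ≤ Mq := le_trans (le_max_of_le_left (sq_nonneg (z.1 i₀)))
    (Finset.le_sup' (fun i : Fin N => max (z.1 i ^ 2) (y.1 i ^ 2)) (Finset.mem_univ i₀))
  -- (1) split the sum
  have h1 : (BV + 2 * Bp * (1 + 12 * β * Mq)) ^ 6 ≤ 32 * (BV ^ 6 + (2 * Bp * (1 + 12 * β * Mq)) ^ 6) :=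
    add_pow_six_le _ _
  -- (2) the bond term
  have h2 : BV ^ 6 ≤ 6 * ∑ i, ez i := by
    have hφ : ∀ x : ℝ, 0 ≤ (fun x : ℝ => x ^ 6) x := fun x => by positivity
    have ha : BV ^ 6 ≤ ∑ i, f i ^ 6 := apply_sup'_le_sum ⟨i₀, hi₀⟩ f hφ
    refine ha.trans ?_
    have hb : ∀ i : Fin N, f i ^ 6 ≤ ∑ j : Fin N, if j.val = i.val + 1 then 3 * (ez j + ez i) else 0 := by
      intro i
      rw [hf, sum_ite_succ_pow_six]
      refine Finset.sum_le_sum fun j _ => ?_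
      split_ifs
      · calc |deriv P.V (z.1 j - z.1 i)| ^ 6 ≤ 3 * (Real.exp ((4 + 24 * β) * (z.1 j) ^ 2) +
              Real.exp ((4 + 24 * β) * (z.1 i) ^ 2)) := abs_deriv_V_sub_pow_six_le hβ ω₂ lam γ _ _
          _ ≤ 3 * (ez j + ez i) := by
              have := exp_mul_sq_mono hκ₁ (z.1 j); have := exp_mul_sq_mono hκ₁ (z.1 i)
              simp only [hez]; linarith
      · exact le_rfl
    set c : Fin N → Fin N → ℝ := fun i j => if j.val = i.val + 1 then (1:ℝ) else 0 with hc
    have hA : ∑ i, ∑ j, c i j * ez j = ∑ j, ez j * ∑ i, c i j := by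
      rw [Finset.sum_comm]
      refine Finset.sum_congr rfl fun j _ => ?_
      rw [Finset.mul_sum]
      exact Finset.sum_congr rfl fun i _ => mul_comm _ _
    have hB : ∑ i, ∑ j, c i j * ez i = ∑ i, ez i * ∑ j, c i j := by
      refine Finset.sum_congr rfl fun i _ => ?_
      rw [Finset.mul_sum]
      exact Finset.sum_congr rfl fun j _ => mul_comm _ _
    have hl := fun j : Fin N => sum_ite_succ_left_le_one (N := N) j
    have hr := fun i : Fin N => sum_ite_succ_right_le_one (N := N) i
    have hez0 : ∀ i, 0 ≤ ez i := fun i => (Real.exp_pos _).le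
    calc ∑ i, f i ^ 6 ≤ ∑ i, ∑ j : Fin N, (if j.val = i.val + 1 then 3 * (ez j + ez i) else 0) :=
          Finset.sum_le_sum fun i _ => hb i
      _ = ∑ i, ∑ j, (3 * (c i j * ez j) + 3 * (c i j * ez i)) := by
          refine Finset.sum_congr rfl fun i _ => Finset.sum_congr rfl fun j _ => ?_
          simp only [hc]
          split_ifs <;> ring
      _ = 3 * ∑ j, ez j * ∑ i, c i j + 3 * ∑ i, ez i * ∑ j, c i j := by
          simp_rw [Finset.sum_add_distrib, ← Finset.mul_sum]
          rw [hA, hB]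
      _ ≤ 3 * ∑ j, ez j * 1 + 3 * ∑ i, ez i * 1 := by
          refine add_le_add (mul_le_mul_of_nonneg_left (Finset.sum_le_sum fun j _ =>
            mul_le_mul_of_nonneg_left (hl j) (hez0 j)) (by norm_num))
            (mul_le_mul_of_nonneg_left (Finset.sum_le_sum fun i _ =>
            mul_le_mul_of_nonneg_left (hr i) (hez0 i)) (by norm_num))
      _ = 6 * ∑ i, ez i := by simp only [mul_one]; ring
  -- (3) the momentum/curvature term
  have h3 : (2 * Bp * (1 + 12 * β * Mq)) ^ 6 ≤ 32 * (Bp ^ 12 + (1 + 12 * β * Mq) ^ 12) :=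
    two_mul_mul_pow_six_le _ _
  have h4 : Bp ^ 12 ≤ ∑ i, (y.2 i) ^ 12 := by
    have hφ : ∀ x : ℝ, 0 ≤ (fun x : ℝ => x ^ 12) x := fun x => by positivity
    have ha := apply_sup'_le_sum ⟨i₀, hi₀⟩ (fun i : Fin N => |y.2 i|) hφ
    simp only [pow_abs] at ha
    refine ha.trans (le_of_eq (Finset.sum_congr rfl fun i _ => abs_of_nonneg (by positivity)))
  have h5 : (1 + 12 * β * Mq) ^ 12 ≤ ∑ i, (ez i + ey i) := by
    have ha : (1 + 12 * β * Mq) ^ 12 ≤ Real.exp (144 * β * Mq) := by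
      have : (1 + 12 * β * Mq) ^ 12 ≤ Real.exp ((12:ℕ) * (12 * β * Mq)) := by
        rw [Real.exp_nat_mul]
        exact pow_le_pow_left₀ (by positivity) (by linarith [Real.add_one_le_exp (12 * β * Mq)]) 12
      refine this.trans (le_of_eq ?_); congr 1; push_cast; ring
    have hφ : ∀ x : ℝ, 0 ≤ (fun x : ℝ => Real.exp (144 * β * x)) x := fun x => (Real.exp_pos _).le
    have hb := apply_sup'_le_sum ⟨i₀, hi₀⟩ (fun i : Fin N => max (z.1 i ^ 2) (y.1 i ^ 2)) hφ
    refine ha.trans (hb.trans (Finset.sum_le_sum fun i _ => ?_))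
    calc Real.exp (144 * β * max (z.1 i ^ 2) (y.1 i ^ 2))
        ≤ Real.exp (144 * β * (z.1 i) ^ 2) + Real.exp (144 * β * (y.1 i) ^ 2) := exp_mul_max_le _ _ _
      _ ≤ ez i + ey i := add_le_add (exp_mul_sq_mono hκ₂ _) (exp_mul_sq_mono hκ₂ _)
  -- (4) assemble
  obtain ⟨hz1, hz2, hz3⟩ := le_oneSiteSum_aux κ z
  obtain ⟨hy1, hy2, hy3⟩ := le_oneSiteSum_aux κ y
  have hsum : ∑ i, (ez i + ey i) = ∑ i, ez i + ∑ i, ey i := Finset.sum_add_distrib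
  rw [hsum] at h5
  have step : (BV + 2 * Bp * (1 + 12 * β * Mq)) ^ 6 ≤
      32 * (6 * ∑ i, ez i + 32 * (∑ i, (y.2 i) ^ 12 + (∑ i, ez i + ∑ i, ey i))) := by
    nlinarith [h1, h2, h3, h4, h5]
  refine step.trans ?_
  simp only [hez, hey] at hz1 hz2 hy1 hy2 ⊢
  nlinarith [hz1, hz2, hz3, hy1, hy2, hy3]

/-- **The Grönwall rate is dominated by one-site sums**: with `A = (ω₂+4) + (3lam+48β) max_i max(q_i(z)², q_i(y)²)`,
for `t ≤ t₀` and `κ ≥ 6t₀(3lam+48β)`, `exp(6 t A) ≤ e^{6t₀(ω₂+4)} (Ψ_κ(z) + Ψ_κ(y))`. [folklore] -/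
theorem exp_mul_coeff_le_oneSiteSum {ω₂ lam β : ℝ} (hω : 0 ≤ ω₂) (hl : 0 ≤ lam) (hβ : 0 ≤ β)
    (hne : (Finset.univ : Finset (Fin N)).Nonempty) {t t₀ κ : ℝ} (htt : t ≤ t₀)
    (hκ : 6 * t₀ * (3 * lam + 48 * β) ≤ κ) (z y : PhaseSpace N) :
    Real.exp (6 * t * ((ω₂ + 4) + (3 * lam + 48 * β) *
        Finset.univ.sup' hne (fun i : Fin N => max (z.1 i ^ 2) (y.1 i ^ 2)))) ≤
      Real.exp (6 * t₀ * (ω₂ + 4)) * ((∑ i, (Real.exp (κ * (z.1 i) ^ 2) + (z.2 i) ^ 12 + 1)) +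
        ∑ i, (Real.exp (κ * (y.1 i) ^ 2) + (y.2 i) ^ 12 + 1)) := by
  set Mq := Finset.univ.sup' hne (fun i : Fin N => max (z.1 i ^ 2) (y.1 i ^ 2)) with hMq
  obtain ⟨i₀, hi₀⟩ := hne
  have hMq0 : 0 ≤ Mq := le_trans (le_max_of_le_left (sq_nonneg (z.1 i₀)))
    (Finset.le_sup' (fun i : Fin N => max (z.1 i ^ 2) (y.1 i ^ 2)) (Finset.mem_univ i₀))
  have hA0 : 0 ≤ (ω₂ + 4) + (3 * lam + 48 * β) * Mq := by positivity
  have h1 : Real.exp (6 * t * ((ω₂ + 4) + (3 * lam + 48 * β) * Mq)) ≤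
      Real.exp (6 * t₀ * (ω₂ + 4)) * Real.exp (6 * t₀ * (3 * lam + 48 * β) * Mq) := by
    rw [← Real.exp_add]
    refine Real.exp_le_exp.2 ?_
    have : 6 * t * ((ω₂ + 4) + (3 * lam + 48 * β) * Mq) ≤ 6 * t₀ * ((ω₂ + 4) + (3 * lam + 48 * β) * Mq) :=
      mul_le_mul_of_nonneg_right (by linarith) hA0
    linarith
  have hφ : ∀ x : ℝ, 0 ≤ (fun x : ℝ => Real.exp (6 * t₀ * (3 * lam + 48 * β) * x)) x := fun x => (Real.exp_pos _).le
  have h2 := apply_sup'_le_sum ⟨i₀, hi₀⟩ (fun i : Fin N => max (z.1 i ^ 2) (y.1 i ^ 2)) hφ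
  have h3 : ∑ i, Real.exp (6 * t₀ * (3 * lam + 48 * β) * max (z.1 i ^ 2) (y.1 i ^ 2)) ≤
      (∑ i, (Real.exp (κ * (z.1 i) ^ 2) + (z.2 i) ^ 12 + 1)) +
        ∑ i, (Real.exp (κ * (y.1 i) ^ 2) + (y.2 i) ^ 12 + 1) := by
    rw [← Finset.sum_add_distrib]
    refine Finset.sum_le_sum fun i _ => ?_
    have hz : 0 ≤ (z.2 i) ^ 12 := by positivity
    have hy : 0 ≤ (y.2 i) ^ 12 := by positivity
    calc Real.exp (6 * t₀ * (3 * lam + 48 * β) * max (z.1 i ^ 2) (y.1 i ^ 2))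
        ≤ Real.exp (6 * t₀ * (3 * lam + 48 * β) * (z.1 i) ^ 2) +
          Real.exp (6 * t₀ * (3 * lam + 48 * β) * (y.1 i) ^ 2) := exp_mul_max_le _ _ _
      _ ≤ Real.exp (κ * (z.1 i) ^ 2) + Real.exp (κ * (y.1 i) ^ 2) :=
          add_le_add (exp_mul_sq_mono hκ _) (exp_mul_sq_mono hκ _)
      _ ≤ _ := by linarith
  exact h1.trans (mul_le_mul_of_nonneg_left (h2.trans h3) (Real.exp_pos _).le)

/-! ### Jensen in time -/

/-- **Jensen for the exponential of a time integral**: `exp(∫₀ᵗ f) ≤ t⁻¹ ∫₀ᵗ exp(t f(s)) ds` for continuous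
`f` and `t > 0`. [folklore] -/
theorem exp_intervalIntegral_le {f : ℝ → ℝ} (hf : Continuous f) {t : ℝ} (ht : 0 < t) :
    Real.exp (∫ s in (0:ℝ)..t, f s) ≤ t⁻¹ * ∫ s in (0:ℝ)..t, Real.exp (t * f s) := by
  have hvol : volume (Ioc (0:ℝ) t) ≠ 0 := by
    rw [Real.volume_Ioc]; exact (ENNReal.ofReal_pos.2 (by linarith)).ne'
  have hvol' : volume (Ioc (0:ℝ) t) ≠ ⊤ := measure_Ioc_lt_top.ne
  have hF : Continuous fun s => t * f s := continuous_const.mul hf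
  have hfi : IntegrableOn (fun s => t * f s) (Ioc 0 t) :=
    (hF.integrableOn_Icc (a := 0) (b := t)).mono_set Ioc_subset_Icc_self
  have hgi : IntegrableOn (Real.exp ∘ fun s => t * f s) (Ioc 0 t) :=
    ((Real.continuous_exp.comp hF).integrableOn_Icc (a := 0) (b := t)).mono_set Ioc_subset_Icc_self
  have key := convexOn_exp.map_set_average_le Real.continuous_exp.continuousOn isClosed_univ hvol hvol'
    (ae_of_all _ fun s => mem_univ _) hfi hgi
  rw [setAverage_eq, setAverage_eq, Real.volume_real_Ioc_of_le ht.le, sub_zero] at key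
  simp only [smul_eq_mul] at key
  rw [intervalIntegral.integral_of_le ht.le, intervalIntegral.integral_of_le ht.le]
  have e : ∫ s in Ioc 0 t, f s = t⁻¹ * ∫ s in Ioc 0 t, t * f s := by
    rw [MeasureTheory.integral_const_mul, ← mul_assoc, inv_mul_cancel₀ ht.ne', one_mul]
  rw [e]
  exact key

/-- **Jensen for the sixth power of a time integral**: `(∫₀ᵗ f)⁶ ≤ t⁵ ∫₀ᵗ f⁶` for continuous `f`, `t > 0`.
[folklore] -/
theorem intervalIntegral_pow_six_le {f : ℝ → ℝ} (hf : Continuous f) {t : ℝ} (ht : 0 < t) :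
    (∫ s in (0:ℝ)..t, f s) ^ 6 ≤ t ^ 5 * ∫ s in (0:ℝ)..t, (f s) ^ 6 := by
  have hvol : volume (Ioc (0:ℝ) t) ≠ 0 := by
    rw [Real.volume_Ioc]; exact (ENNReal.ofReal_pos.2 (by linarith)).ne'
  have hvol' : volume (Ioc (0:ℝ) t) ≠ ⊤ := measure_Ioc_lt_top.ne
  have hfi : IntegrableOn f (Ioc 0 t) := (hf.integrableOn_Icc (a := 0) (b := t)).mono_set Ioc_subset_Icc_self
  have hgi : IntegrableOn ((fun x : ℝ => x ^ 6) ∘ f) (Ioc 0 t) :=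
    (((continuous_pow 6).comp hf).integrableOn_Icc (a := 0) (b := t)).mono_set Ioc_subset_Icc_self
  have hconv : ConvexOn ℝ univ fun x : ℝ => x ^ 6 := Even.convexOn_pow (by decide)
  have key := hconv.map_set_average_le (continuous_pow 6).continuousOn isClosed_univ hvol hvol'
    (ae_of_all _ fun s => mem_univ _) hfi hgi
  rw [setAverage_eq, setAverage_eq, Real.volume_real_Ioc_of_le ht.le, sub_zero] at key
  simp only [smul_eq_mul] at key
  rw [intervalIntegral.integral_of_le ht.le, intervalIntegral.integral_of_le ht.le]
  rw [mul_pow] at key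
  have ht6 : 0 < t ^ 6 := by positivity
  have := mul_le_mul_of_nonneg_left key ht6.le
  calc (∫ s in Ioc 0 t, f s) ^ 6 = t ^ 6 * (t⁻¹ ^ 6 * (∫ s in Ioc 0 t, f s) ^ 6) := by
        field_simp
    _ ≤ t ^ 6 * (t⁻¹ * ∫ s in Ioc 0 t, f s ^ 6) := this
    _ = t ^ 5 * ∫ s in Ioc 0 t, f s ^ 6 := by field_simp

end Summit.AtomisticToContinuum.FouriersLaw.Theorems.ChainVariation

end
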